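import Literature.MathematicalPhysics.QuantumFieldTheory.ConformalBootstrap3D.PointKernelK57Data
import Literature.MathematicalPhysics.QuantumFieldTheory.ConformalBootstrap3D.PointKernelParts

/-!
# K57 certificate, kernel part file P7: one-cell head segments 148 in level ranges

The head cells whose kernel evaluation exceeds one `decide` are one-cell segments of `hsegsK57`; each is
checked by `PCert.hPartSideOK` (side conditions) and `PCert.hPartOK` per level range `[n_lo, n_lo + count)`
against an integer claim, the claims summing to `≥ 0` (`PointKernel.partsOK`); soundness is
`PCert.hParts_sound` (`PointKernelParts`).  The part files `P1, P2, …` are mutually independent (each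
imports only the data file); the ranges of one cell may span several of them, and the per-cell
conclusions `hparts_i` / `hcell_i` of those cells are assembled in `PointKernelK57.lean`.
Estimated kernel time 204 s.
-/

set_option maxRecDepth 100000
set_option maxHeartbeats 0

namespace Literature.MathematicalPhysics.QuantumFieldTheory.ConformalBootstrap3D.PointKernelK57

open Literature.MathematicalPhysics.QuantumFieldTheory.ConformalBootstrap3D.PointKernel

/-- levels `[36, 41)` of segment 148: partial lower sum `≥` claim. [folklore] -/
theorem part_148_3 : certK57.hPartOK (PCert.segAt hsegsK57 148) JHK57 36 5 (1917107219990549340718731318194040488) = true := by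
  decide +kernel

/-- levels `[41, 45)` of segment 148: partial lower sum `≥` claim. [folklore] -/
theorem part_148_4 : certK57.hPartOK (PCert.segAt hsegsK57 148) JHK57 41 4 (934812225880707303621387044198949996) = true := by
  decide +kernel

/-- levels `[45, 49)` of segment 148: partial lower sum `≥` claim. [folklore] -/
theorem part_148_5 : certK57.hPartOK (PCert.segAt hsegsK57 148) JHK57 45 4 (597149649078434246995882920432616499) = true := by
  decide +kernel

/-- levels `[49, 52)` of segment 148: partial lower sum `≥` claim. [folklore] -/
theorem part_148_6 : certK57.hPartOK (PCert.segAt hsegsK57 148) JHK57 49 3 (298444716696551150466801718150271249) = true := by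
  decide +kernel

end Literature.MathematicalPhysics.QuantumFieldTheory.ConformalBootstrap3D.PointKernelK57
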